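import Summits.SmoothPoincare4.SmoothPoincare4.Theorems.SoloInformedSliceDiscTransport
import Literature.Geometry.Manifold.EmbeddingRangeDiffeomorph
import Summits.SmoothPoincare4.SmoothPoincare4.Statement
import HarnessLib
import HarnessLib.Audit.Tags

/-!
# Punctured homotopy 4-spheres in `S⁴` and knots slice in a homotopy ball

Solo informed SmoothPoincare4, session 19.  The first conjunct of the landed path
`SPC4 ⇐ EMB ∧ SS4 ∧ (Γ₄ = 0)` (`SoloInformedEmbeddingRoute.lean`) is the Poincaré-ball embedding
conjecture EMB (Hass–Kirby 2025, Question 4.2).  This file types its boundary-free ("punctured")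
form and hangs the homotopy-ball-slice programme of Freedman–Gompf–Morrison–Walker 2010 and
Manolescu–Piccirillo 2023 formally under it:

* `PuncturedPoincareSphereEmbedding` — **every punctured homotopy 4-sphere is a standard open
  subset of `S⁴`**: for every closed smooth `Σ ≃ₕ S⁴` and every point `p`, the open manifold
  `Σ ∖ {p}` is diffeomorphic to an open subset of the round `S⁴`.
* `puncturedPoincareSphereEmbedding_of_smoothPoincare4` — SPC4 implies it (restrict a
  diffeomorphism `Σ ≅ S⁴`).
* `isSmoothlySlice_of_isHomotopyBallSlice_of_puncturedEmbedding` — **it implies that every knot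
  which is slice in a homotopy 4-ball is slice** (`Knot.IsHomotopyBallSlice → Knot.IsSmoothlySlice`,
  notions of `Literature/Topology/FourManifolds/HomotopyBallSlice.lean`).  Hence a single knot that
  is slice in a homotopy ball but not in `B⁴` — the object sought by the `s`-invariant programme
  (FGMW 2010 §1; MP 2023, Thm. 1.6 and the five knots of Thm. 1.7; the surviving candidates of the
  2025 census) — refutes not only SPC4 (`exists_exotic_of_isHomotopyBallSlice_not_isSmoothlySlice`,
  proved in `HomotopyBallSliceProofs.lean`) but already the embedding conjunct of the path.

Proof of the main implication (all steps proved here, no facts assumed): let `(e, f)` be a slice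
disc datum for `K` in `Σ` (`Knot.IsSliceDiscIn`).  (1) *Shrink*: reparametrise ball and disc by
the radial diffeomorphisms `univBall 0 √2 : ℝⁿ ≅ B(0, √2)` (identity on the unit spheres,
preserving the unit balls), so that both maps have image inside `e(B(0,√2)) ∪ f(B(0,√2))`
(`isSliceDiscIn_shrink`, tool file `SoloInformedSliceDiscTransport.lean`).  (2) *General position*: the set of `y ∈ ℝ⁴` with `e y ∈ f(ℝ²)` is
Lebesgue-null — it is the image of a planar set under the `C¹` map `e⁻¹ ∘ f ∘ π` (Sard-type lemma
`addHaar_image_eq_zero_of_differentiableOn_of_addHaar_eq_zero`) — so some `y` with `‖y‖ > 2` has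
`p = e y` off both images (`exists_norm_gt_apply_notMem_image`).  (3) *Transport*: a diffeomorphism
`ψ : Σ ∖ {p} ≅ U ⊆ S⁴` carries the shrunk datum to a slice disc datum in `S⁴`
(`isSliceDiscIn_transport_opens`; the differential of `ψ` is injective because `ψ⁻¹ ∘ ψ = id`
near every point).  (4) Palais' ball-complement theorem in `S⁴` and neatening, both PROVED in
`HomotopyBallSliceProofs.lean` (`palais_ballComplement_sphere_four_holds`,
`IsSliceDiscIn.exists_isProperDisc`, `isSmoothlySlice_of_isProperDisc_holds`), give a slice disc in
`B⁴`.

Sources: M. Freedman, R. Gompf, S. Morrison, K. Walker, *Man and machine thinking about the smooth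
4-dimensional Poincaré conjecture*, Quantum Topol. 1 (2010) 171–208, §1–2 [FreedmanGompfMorrisonWalker2010];
C. Manolescu, L. Piccirillo, *From zero surgeries to candidates for exotic definite 4-manifolds*,
J. Lond. Math. Soc. 108 (2023), §1 and Lemma 3.3 [ManolescuPiccirillo2023]; J. Hass, R. Kirby,
*Characterizing the 4-sphere*, J. Open Math. Problems 1 (2025), §4 Question 4.2 [HassKirby2025];
R. Palais, *Extending diffeomorphisms*, Proc. AMS 11 (1960), Thm. B [Palais1960].
No new axioms, no `sorry`; nothing here decides `PuncturedPoincareSphereEmbedding`.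
-/

noncomputable section

open scoped Manifold ContDiff Topology
open Set Function ContinuousMap MeasureTheory

namespace Summit.SmoothPoincare4.SmoothPoincare4.Theorems

open Literature.Topology.FourManifolds Literature.Geometry.Manifold

/-! ### The statement -/

/-- **Punctured homotopy 4-spheres are standard open subsets of `S⁴`** (boundary-free form of the
Poincaré-ball embedding conjecture, Hass–Kirby 2025, Question 4.2: "Does every smooth homotopy
4-ball with `S³` boundary smoothly embed in `S⁴`?").  For every Hausdorff second-countable compact
smooth 4-manifold `M` (model `ℝ⁴`, so `∂M = ∅`) homotopy equivalent to `S⁴` and every point `p`, the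
open submanifold `M ∖ {p}` is diffeomorphic to an open subset of the round `S⁴`.  Open; implied by
SPC4 (`puncturedPoincareSphereEmbedding_of_smoothPoincare4`).  In ordinary mathematics it is
equivalent to the ball form `PoincareBallEmbeddingConjecture` (`SoloInformedGabaiPoincareBalls.lean`)
by the collar argument `Σ ∖ {p} ≅ Σ° ∪ (S³ × [0,1))`, `Σ = W ∪_{S³} B⁴`; that equivalence is NOT
formalised here.  OPEN CONJECTURE — not dischargeable: use as a hypothesis.
[cite: HassKirby2025, §4 Question 4.2] -/
@[conjecture] def PuncturedPoincareSphereEmbedding : Prop :=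
  ∀ (M : Type) [TopologicalSpace M] [T2Space M] [SecondCountableTopology M]
    [ChartedSpace (EuclideanSpace ℝ (Fin 4)) M] [IsManifold (𝓡 4) ∞ M] [CompactSpace M],
    Nonempty (M ≃ₕ (Metric.sphere (0 : EuclideanSpace ℝ (Fin (4 + 1))) 1)) → ∀ p : M,
      ∃ U : TopologicalSpace.Opens (Metric.sphere (0 : EuclideanSpace ℝ (Fin (4 + 1))) 1),
        Nonempty ((⟨({p}ᶜ : Set M), isOpen_compl_singleton⟩ : TopologicalSpace.Opens M)
          ≃ₘ⟮𝓡 4, 𝓡 4⟯ U)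

/-- **SPC4 implies the punctured-embedding property**: restrict a diffeomorphism `M ≅ S⁴` to
`M ∖ {p}`; its image is open and two smooth embeddings with the same image have diffeomorphic
sources (`nonempty_diffeomorph_of_range_eq`, Lee 2013 Thm. 5.31). [folklore] -/
theorem puncturedPoincareSphereEmbedding_of_smoothPoincare4 (h : SmoothPoincare4) :
    PuncturedPoincareSphereEmbedding := by
  intro M _ _ _ _ _ _ hM p
  obtain ⟨Ψ⟩ := h M inferInstance inferInstance hM.some
  set V : TopologicalSpace.Opens M := ⟨({p}ᶜ : Set M), isOpen_compl_singleton⟩ with hV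
  have h₁ : Manifold.IsSmoothEmbedding (𝓡 4) (𝓡 4) ∞ (Ψ ∘ (Subtype.val : V → M)) :=
    (Manifold.IsSmoothEmbedding.of_opens V).diffeomorph_comp Ψ
  have hopen : IsOpen (range (Ψ ∘ (Subtype.val : V → M))) := by
    rw [range_comp, Subtype.range_coe]
    exact Ψ.toHomeomorph.isOpenMap _ V.isOpen
  set U : TopologicalSpace.Opens (Metric.sphere (0 : EuclideanSpace ℝ (Fin (4 + 1))) 1) := ⟨_, hopen⟩ with hU
  have h₂ : Manifold.IsSmoothEmbedding (𝓡 4) (𝓡 4) ∞ (Subtype.val : U → (Metric.sphere (0 : EuclideanSpace ℝ (Fin (4 + 1))) 1)) :=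
    Manifold.IsSmoothEmbedding.of_opens U
  exact ⟨U, nonempty_diffeomorph_of_range_eq h₁ h₂ (by rw [Subtype.range_coe]; rfl)⟩

/-! ### The main implication -/

/-- **If every punctured homotopy 4-sphere is a standard open subset of `S⁴`, then every knot
that is slice in a homotopy 4-ball is slice.**  Freedman–Gompf–Morrison–Walker 2010, §1–2 (the
logic of the `s`-invariant approach to SPC4), with the embedding conjunct in place of SPC4: shrink
the datum, puncture `Σ` at a point in general position, transport along `Σ ∖ {p} ≅ U ⊆ S⁴`, and
pull the disc back to `B⁴` by Palais' ball-complement theorem and neatening (both proved in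
`HomotopyBallSliceProofs.lean`).  Contrapositive: a knot slice in a homotopy ball but not in `B⁴`
refutes `PuncturedPoincareSphereEmbedding`, i.e. the EMB conjunct of the path, not merely SPC4.
[cite: FreedmanGompfMorrisonWalker2010, §2 p. 6 and Fact 2.1] [cite: ManolescuPiccirillo2023, §1] -/
theorem isSmoothlySlice_of_isHomotopyBallSlice_of_puncturedEmbedding
    (hE : PuncturedPoincareSphereEmbedding) (K : Knot) (hK : K.IsHomotopyBallSlice) :
    K.IsSmoothlySlice := by
  obtain ⟨M, _, _, _, _, _, _, hM, e, f, hef⟩ := hK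
  -- (1) shrink
  have hef' := isSliceDiscIn_shrink hef
  -- (2) general position: a puncture off both images
  obtain ⟨y, hy, hyC⟩ := exists_norm_gt_apply_notMem_image hef.isSmoothEmbedding hef.contMDiff
    (Metric.ball (0 : EuclideanSpace ℝ (Fin 2)) (√2))
  have h22 : √2 < (2 : ℝ) := by
    rw [Real.sqrt_lt' (by norm_num)]; norm_num
  set V : TopologicalSpace.Opens M := ⟨({e y}ᶜ : Set M), isOpen_compl_singleton⟩ with hV
  have heV : ∀ z, (e ∘ OpenPartialHomeomorph.univBall (0 : EuclideanSpace ℝ (Fin 4)) (√2)) z ∈ V := by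
    intro z hz
    have hz' : OpenPartialHomeomorph.univBall (0 : EuclideanSpace ℝ (Fin 4)) (√2) z = y :=
      hef.isSmoothEmbedding.isEmbedding.injective (mem_singleton_iff.mp hz)
    have := norm_univBall_sqrt_two_lt z
    rw [hz'] at this
    linarith
  have hfV : ∀ x, (f ∘ OpenPartialHomeomorph.univBall (0 : EuclideanSpace ℝ (Fin 2)) (√2)) x ∈ V := by
    intro x hx
    refine hyC ⟨OpenPartialHomeomorph.univBall (0 : EuclideanSpace ℝ (Fin 2)) (√2) x, ?_, (mem_singleton_iff.mp hx).symm ▸ rfl⟩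
    rw [mem_ball_zero_iff]
    exact norm_univBall_sqrt_two_lt x
  -- (3) transport along `Σ ∖ {p} ≅ U ⊆ S⁴`
  obtain ⟨U, ⟨ψ⟩⟩ := hE M hM (e y)
  obtain ⟨e', f', h'⟩ := isSliceDiscIn_transport_opens hef' V heV hfV ψ
  -- (4) Palais + neatening
  obtain ⟨U', c, hc₁, hc₂⟩ := Knot.palais_ballComplement_sphere_four_holds e' h'.isSmoothEmbedding
  obtain ⟨g, hg⟩ := h'.exists_isProperDisc c hc₁ hc₂
  exact Knot.isSmoothlySlice_of_isProperDisc_holds K g hg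

/-- Contrapositive, in the shape of the FGMW lemma: **a knot slice in a homotopy 4-ball but not
slice refutes the punctured-embedding property** (hence the Poincaré-ball embedding conjecture).
[cite: FreedmanGompfMorrisonWalker2010, §2 Fact 2.1] -/
theorem not_puncturedPoincareSphereEmbedding_of_isHomotopyBallSlice_not_isSmoothlySlice
    (h : ∃ K : Knot, K.IsHomotopyBallSlice ∧ ¬ K.IsSmoothlySlice) :
    ¬ PuncturedPoincareSphereEmbedding := fun hE ↦ by
  obtain ⟨K, hK, hKs⟩ := h
  exact hKs (isSmoothlySlice_of_isHomotopyBallSlice_of_puncturedEmbedding hE K hK)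

end Summit.SmoothPoincare4.SmoothPoincare4.Theorems

end
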